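import Literature.AlgebraicGeometry.HodgeTheory.SmoothHypersurfaceGeometricGenusLowerBound
import Literature.AlgebraicGeometry.HodgeTheory.SmoothHypersurfaceBettiNumbersConstant
import Literature.AlgebraicGeometry.HodgeTheory.FermatEvenMiddleBettiNumber
import Literature.AlgebraicGeometry.HodgeTheory.FermatOddDegreeRestriction
import Literature.AlgebraicGeometry.HodgeTheory.BettiIrregularityHodgeTateType
import HarnessLib

/-!
# The genus of a smooth plane curve of degree `d` is `(d − 1)(d − 2)/2`: `b₁(C_F) = (d − 1)(d − 2)` and `h^{1,0}(C_F) = C(d−1, 2)`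
# — the `n = 1` clause of the named fact `Arapura2012_hypersurface_geometricGenus`, PROVED (Arapura 2012 §17.3 (17.3.1); Hartshorne IV Ex. 1.8 / V Ex. 1.5)

Family `hodge`, layer `Literature/AlgebraicGeometry/HodgeTheory`. PROOF FILE (theorems only: no definition, no named fact,
no instance; D-0026 net debt `0`). D. Arapura, *Algebraic Geometry over the Complex Numbers* (2012), §17.3 (17.3.1):
`h^{0,n−1}(X) = C(d−1, n)` for a nonsingular degree-`d` hypersurface `X ⊂ ℙⁿ`; at `n = 2` this is the **genus–degree formula**
`g(C) = (d − 1)(d − 2)/2` for a smooth plane curve (R. Hartshorne, *Algebraic Geometry* (1977), I Ex. 7.2 (b), II Ex. 8.20.3,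
V Example 1.5.1: "a nonsingular curve of degree `d` in `ℙ²` has genus `½(d−1)(d−2)`"), equivalently `b₁(C(ℂ)) = 2g = (d−1)(d−2)`.
The tree's named fact `Arapura2012_hypersurface_geometricGenus` (file `SmoothHypersurfaceHodgeBettiNumbers`) asserts
`h^{n,0}(X_F) = C(d−1, n+1)` for ALL `n ≥ 1`; this file PROVES ITS `n = 1` CLAUSE (the general clause, `n ≥ 2`, needs
`h^{n,0} ≤ C(d−1, n+1)`, i.e. that every holomorphic `n`-form is a residue — open in the tree).

The proof is a SANDWICH of tree theorems, with no cited input: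
* LOWER bound `h^{1,0}(C_F) ≥ C(d−1, 2)` — Griffiths' residues at pole order one inject `S^{d−3} ↪ H^{1,0}`
  (`choose_le_geometricGenus`, file `SmoothHypersurfaceGeometricGenusLowerBound`), and `b₁ = 2 h^{1,0}` (Hodge symmetry,
  `BettiUniverse.finrank_bettiCohomology_one_eq_two_mul`);
* UPPER bound `b₁(C_F) ≤ (d−1)(d−2)` — `b₁` is constant over the universal family of smooth plane curves of degree `d` (Ehresmann,
  `finrank_bettiCohomology_hypersurface_eq_of_isNonsingularForm`), and at the Fermat curve `X¹_d` the character decomposition gives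
  `b₁(X¹_d) ≤ #{β ∈ (ℤ/d ∖ 0)³ : Σ βᵢ = 0} = (d−1)(d−2)` (`finrank_complexBetti_fermat_odd_le`, `card_fermatAdmissible_succ_add`).

* `card_fermatAdmissible_three_eq` — `#{β ∈ (ℤ/m ∖ 0)³ : Σ βᵢ = 0} = (m − 1)(m − 2)` (`= 2 C(m−1, 2)`).
* `finrank_bettiCohomology_one_fermatCurve_le` — `b₁(X¹_m) ≤ (m−1)(m−2)`.
* **`finrank_bettiCohomology_one_planeCurve`** — `b₁(C_F) = 2 C(d−1, 2)` for every nonsingular ternary form `F` of degree `d ≥ 1`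
  with `C_F` smooth projective; `finrank_bettiCohomology_one_planeCurve'` — `= (d−1)(d−2)`; `finrank_bettiCohomology_one_fermatCurve`.
* **`hodgeNumber_one_zero_planeCurve`** — `h^{1,0}(C_F) = C(d−1, 2)` (the genus), and
  **`Arapura2012_hypersurface_geometricGenus_one`** — the `n = 1` clause of the named fact, in its own spelling.

Written by the prover seat `hodge-nonav-prover-Bx` (g10) (lane: the eigen-Hodge-number binders of route
`HodgeConjecture/CyclicUnitaryPowers`; PG's `n = 2` clause is what crux K1-A consumes and stays cited).

## References

* [Arapura2012] D. Arapura, Algebraic Geometry over the Complex Numbers, Universitext, Springer 2012, §17.3 (17.3.1), Cor. 17.3.5.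
* [Hartshorne1977] R. Hartshorne, Algebraic Geometry, Springer 1977, I Ex. 7.2 (b), II Ex. 8.20.3, V Example 1.5.1.
* [VoisinHodgeI2002] C. Voisin, Hodge Theory and Complex Algebraic Geometry I, CUP 2002, Thm. 9.3, §9.2.1, Cor. 6.12–6.13.
* [Shioda1979HodgeFermat] T. Shioda, The Hodge conjecture for Fermat varieties, Math. Ann. 245 (1979), §1 (1.3)–(1.4).
-/

noncomputable section

open CategoryTheory AlgebraicGeometry MvPolynomial

namespace Literature.AlgebraicGeometry.HodgeTheory

open Literature.AlgebraicGeometry.Motives Literature.AlgebraicTopology.SingularHomology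

/-! ### The character count for the Fermat curve -/

/-- `N₀ = 1`: the empty character is (vacuously) admissible. [folklore] -/
private theorem card_fermatAdmissible_zero (m : ℕ) [NeZero m] :
    Fintype.card {α : Fin 0 → ZMod m // (∀ i, α i ≠ 0) ∧ ∑ i, α i = 0} = 1 := by
  rw [Fintype.card_eq_one_iff]
  refine ⟨⟨Fin.elim0, fun i ↦ i.elim0, by simp⟩, fun α ↦ Subtype.ext (funext fun i ↦ i.elim0)⟩

/-- **`#{β ∈ (ℤ/m ∖ 0)³ : Σ βᵢ = 0} = (m − 1)(m − 2)`** (`m ≥ 1`): three steps of the recursion `N_{k+1} + N_k = (m−1)^k`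
(`card_fermatAdmissible_succ_add`) from `N₀ = 1`. This is `2g(X¹_m)`, the number of admissible characters of the Fermat
curve. [cite: Shioda1979HodgeFermat, §1 (1.3)–(1.4)] -/
theorem card_fermatAdmissible_three_eq (m : ℕ) [NeZero m] :
    Fintype.card {α : Fin 3 → ZMod m // (∀ i, α i ≠ 0) ∧ ∑ i, α i = 0} = (m - 1) * (m - 2) := by
  have h0 : Fintype.card {α : Fin 1 → ZMod m // (∀ i, α i ≠ 0) ∧ ∑ i, α i = 0} +
      Fintype.card {α : Fin 0 → ZMod m // (∀ i, α i ≠ 0) ∧ ∑ i, α i = 0} = (m - 1) ^ 0 :=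
    card_fermatAdmissible_succ_add m 0
  have h1 : Fintype.card {α : Fin 2 → ZMod m // (∀ i, α i ≠ 0) ∧ ∑ i, α i = 0} +
      Fintype.card {α : Fin 1 → ZMod m // (∀ i, α i ≠ 0) ∧ ∑ i, α i = 0} = (m - 1) ^ 1 :=
    card_fermatAdmissible_succ_add m 1
  have h2 : Fintype.card {α : Fin 3 → ZMod m // (∀ i, α i ≠ 0) ∧ ∑ i, α i = 0} +
      Fintype.card {α : Fin 2 → ZMod m // (∀ i, α i ≠ 0) ∧ ∑ i, α i = 0} = (m - 1) ^ 2 :=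
    card_fermatAdmissible_succ_add m 2
  rw [card_fermatAdmissible_zero] at h0
  obtain ⟨t, rfl⟩ : ∃ t, m = t + 1 := ⟨m - 1, by have := NeZero.one_le (n := m); omega⟩
  simp only [Nat.add_sub_cancel, pow_zero, pow_one] at h0 h1 h2 ⊢
  rcases t with _ | t
  · simp at h2 ⊢
    omega
  · have : (t + 1) ^ 2 = (t + 1) * t + (t + 1) := by ring
    rw [show t + 1 + 1 - 2 = t by omega]
    omega

/-! ### The first Betti number of the Fermat curve and of every smooth plane curve -/

variable {d : ℕ}

/-- **`b₁(X¹_m) ≤ (m − 1)(m − 2)`** for the Fermat curve `x₀^m + x₁^m + x₂^m = 0` (`m ≥ 1`; over `ℚ`): the character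
decomposition of `H¹(X¹_m(ℂ); ℂ)` has at most one line per admissible character and nothing else
(`finrank_complexBetti_fermat_odd_le`), and there are `(m−1)(m−2)` admissible characters. [cite: Shioda1979HodgeFermat, §1 (1.3)–(1.4)] -/
theorem finrank_bettiCohomology_one_fermatCurve_le (m : ℕ) [NeZero m] :
    Module.finrank ℚ (bettiCohomology (fermatHypersurface 1 m) 1) ≤ (m - 1) * (m - 2) := by
  have h : Module.finrank ℂ (complexBetti (fermatHypersurface 1 m) 1) ≤
      Fintype.card {β : Fin 3 → ZMod m // (∀ i, β i ≠ 0) ∧ ∑ i, β i = 0} :=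
    finrank_complexBetti_fermat_odd_le (m := m) 0
  rw [card_fermatAdmissible_three_eq] at h
  have hq : Module.finrank ℚ (bettiCohomology (fermatHypersurface 1 m) 1) =
      Module.finrank ℂ (complexBetti (fermatHypersurface 1 m) 1) := by
    change Module.finrank ℚ (singularCohomology ℚ ℚ (ComplexPoints (fermatHypersurface 1 m)) 1) =
      Module.finrank ℂ (singularCohomology ℂ ℂ (ComplexPoints (fermatHypersurface 1 m)) 1)
    rw [finrank_singularCohomology_eq_bettiNumber_of_field, finrank_singularCohomology_eq_bettiNumber_of_field,
      bettiNumber_eq_of_algebra ℚ ℂ]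
  omega

/-- `2 C(d−1, 2) = (d − 1)(d − 2)`. [folklore] -/
private theorem two_mul_choose_two (d : ℕ) : 2 * Nat.choose (d - 1) 2 = (d - 1) * (d - 2) := by
  rw [Nat.choose_two_right]
  obtain ⟨k, hk⟩ := Nat.even_mul_pred_self (d - 1)
  have h2 : d - 1 - 1 = d - 2 := by omega
  rw [h2] at hk ⊢
  omega

/-- **`b₁(C_F) = 2 C(d−1, 2)` for every smooth plane curve `C_F = V₊(F) ⊂ ℙ²`, `F` a nonsingular ternary form of degree `d ≥ 1`**
(`b₁ = 2g`, `g = (d−1)(d−2)/2`). SANDWICH: `b₁ = 2h^{1,0} ≥ 2 C(d−1, 2)` by Griffiths' residues at pole order one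
(`choose_le_geometricGenus`) and Hodge symmetry; `b₁(C_F) = b₁(X¹_d) ≤ (d−1)(d−2)` by Ehresmann on the universal family of smooth
plane curves (`finrank_bettiCohomology_hypersurface_eq_of_isNonsingularForm`) and the character count of the Fermat curve.
[cite: Arapura2012, §17.3 (17.3.1)] [cite: Hartshorne1977, V Example 1.5.1] [cite: VoisinHodgeI2002, Thm. 9.3 and Cor. 6.12–6.13] -/
theorem finrank_bettiCohomology_one_planeCurve (hHD : exists_isReal_hodgeModel) (hd : 1 ≤ d)
    {F : MvPolynomial (Fin (1 + 2)) ℂ} (hF : F.IsHomogeneous d) (hJ : SmoothHypersurface.IsNonsingularForm ℂ F)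
    (hX : IsSmoothProjective 1 (SmoothHypersurface.hypersurface F)) :
    Module.finrank ℚ (bettiCohomology (SmoothHypersurface.hypersurface F) 1) = 2 * Nat.choose (d - 1) 2 := by
  haveI : NeZero d := ⟨by omega⟩
  -- lower bound: residues and Hodge symmetry
  have hlow : 2 * Nat.choose (d - 1) 2 ≤ Module.finrank ℚ (bettiCohomology (SmoothHypersurface.hypersurface F) 1) := by
    rw [BettiUniverse.finrank_bettiCohomology_one_eq_two_mul hHD hX]
    exact Nat.mul_le_mul_left 2 (choose_le_geometricGenus hHD le_rfl hF hJ hX)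
  -- upper bound: Ehresmann + the Fermat curve
  have hfermat : SmoothHypersurface.IsNonsingularForm ℂ (fermatPolynomial ℂ 1 d) :=
    SmoothHypersurface.isNonsingularForm_sum_X_pow (Nat.cast_ne_zero.mpr (NeZero.ne d))
  have hup : Module.finrank ℚ (bettiCohomology (SmoothHypersurface.hypersurface F) 1) ≤ (d - 1) * (d - 2) := by
    rw [finrank_bettiCohomology_hypersurface_eq_of_isNonsingularForm (n := 1) hd hF hJ
      (isHomogeneous_fermatPolynomial 1 d) hfermat 1]
    exact finrank_bettiCohomology_one_fermatCurve_le d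
  have h2 := two_mul_choose_two d
  omega

/-- **`b₁(C_F) = (d − 1)(d − 2)`** for every smooth plane curve of degree `d ≥ 1` (`= 2g`). [cite: Hartshorne1977, V Example 1.5.1]
[cite: Arapura2012, §17.3 (17.3.1)] -/
theorem finrank_bettiCohomology_one_planeCurve' (hHD : exists_isReal_hodgeModel) (hd : 1 ≤ d)
    {F : MvPolynomial (Fin (1 + 2)) ℂ} (hF : F.IsHomogeneous d) (hJ : SmoothHypersurface.IsNonsingularForm ℂ F)
    (hX : IsSmoothProjective 1 (SmoothHypersurface.hypersurface F)) :
    Module.finrank ℚ (bettiCohomology (SmoothHypersurface.hypersurface F) 1) = (d - 1) * (d - 2) := by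
  rw [finrank_bettiCohomology_one_planeCurve hHD hd hF hJ hX, two_mul_choose_two]

/-- **`b₁(X¹_m) = (m − 1)(m − 2)` for the Fermat curve** (`m ≥ 1`): the sandwich at the Fermat curve itself (smooth projective
for `m ≥ 1`, `isSmoothProjective_fermatHypersurface`). [cite: Shioda1979HodgeFermat, §1 (1.3)–(1.4)] [cite: Hartshorne1977, V Example 1.5.1] -/
theorem finrank_bettiCohomology_one_fermatCurve (hHD : exists_isReal_hodgeModel) (m : ℕ) [NeZero m] :
    Module.finrank ℚ (bettiCohomology (fermatHypersurface 1 m) 1) = (m - 1) * (m - 2) :=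
  finrank_bettiCohomology_one_planeCurve' hHD NeZero.one_le (isHomogeneous_fermatPolynomial 1 m)
    (SmoothHypersurface.isNonsingularForm_sum_X_pow (Nat.cast_ne_zero.mpr (NeZero.ne m)))
    (isSmoothProjective_fermatHypersurface le_rfl NeZero.one_le)

/-! ### The genus: `h^{1,0}(C_F) = C(d−1, 2)` -/

/-- **The genus of a smooth plane curve of degree `d` is `C(d−1, 2) = (d−1)(d−2)/2`**: `h^{1,0}(C_F) = C(d−1, 2)` on the tree's
Hodge structure `H¹(C_F)` (`b₁ = 2 h^{1,0}` and `b₁ = 2 C(d−1, 2)`). [cite: Arapura2012, §17.3 (17.3.1) and Cor. 17.3.5]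
[cite: Hartshorne1977, V Example 1.5.1] -/
theorem hodgeNumber_one_zero_planeCurve (hHD : exists_isReal_hodgeModel) (hd : 1 ≤ d)
    {F : MvPolynomial (Fin (1 + 2)) ℂ} (hF : F.IsHomogeneous d) (hJ : SmoothHypersurface.IsNonsingularForm ℂ F)
    (hX : IsSmoothProjective 1 (SmoothHypersurface.hypersurface F)) :
    (BettiUniverse.hodge hHD hX 1).hodgeNumber 1 0 = Nat.choose (d - 1) 2 := by
  have h := finrank_bettiCohomology_one_planeCurve hHD hd hF hJ hX
  rw [BettiUniverse.finrank_bettiCohomology_one_eq_two_mul hHD hX] at h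
  omega

/-- **The `n = 1` clause of the named fact `Arapura2012_hypersurface_geometricGenus`, PROVED**: for a nonsingular ternary form
`F` of degree `d ≥ 1` with `C_F = V₊(F)` smooth projective of dimension `1`, `dim_ℂ H^{1,0}(C_F) = C(d−1, 2)` — literally the
fact's body at `n = 1` (`hodgeNumber = finrank ∘ piece` by `rfl`). The clauses `n ≥ 2` remain the content of the fact.
[cite: Arapura2012, §17.3 (17.3.1) and Cor. 17.3.5] [cite: Hartshorne1977, V Example 1.5.1] -/
theorem Arapura2012_hypersurface_geometricGenus_one (hHD : exists_isReal_hodgeModel) ⦃d : ℕ⦄ (hd : 1 ≤ d)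
    (F : MvPolynomial (Fin (1 + 2)) ℂ) (hF : F.IsHomogeneous d) (hJ : SmoothHypersurface.IsNonsingularForm ℂ F)
    (hX : IsSmoothProjective 1 (SmoothHypersurface.hypersurface F)) :
    Module.finrank ℂ ↥((BettiUniverse.hodge hHD hX 1).piece (1 : ℤ) 0) = Nat.choose (d - 1) (1 + 1) :=
  hodgeNumber_one_zero_planeCurve hHD hd hF hJ hX

end Literature.AlgebraicGeometry.HodgeTheory

end
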